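/-
Copyright: the b2b-balaban T⁴-continuum CRUX team, row NE7b OWNER lineage `t4-ne7b-p1` (gen 124). Project licence.
-/
import Summits.QuantumFields.BalabanUV.T4Continuum.Spine.NE7b.SupZdResponseKernel

/-!
# THE INFINITE-VOLUME FLUCTUATION COVARIANCE, POINTWISE: on `ℤ^d`, for the road's class (`V : ℤ^d → [−λ, Λ]`, `d ≥ 3`, ANY bounded block
# columns `Ψ`, `M = T_∞⁻¹`), the bounded solution `u = H_V⁻¹f` of a source in ONE block `b₀` splits as `u = h + (u − h)` with the RESPONSE
# PART `h = Σ′_{b″}m(b″)h_{b″}` (`m` = block means of `u`, `h_{b″}` = (200)'s response kernels) and the FLUCTUATION PART `u − h = C_∞f`: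
# `|u − h|(p) ≤ C·‖f‖_∞·e^{−δ|blk n p − b₀|₁}`, `Q′(u − h) = 0`, `H_V(u − h) = f − (Σ′_{b″}m(b″)M(·,b″))∘blk` — the displays of
# `C = H⁻¹ − H⁻¹Q′*(Q′H⁻¹Q′*)⁻¹Q′H⁻¹` ((100)∕(139)) in infinite volume, `(C, δ)` from `(d, a, λ, Λ)` ONLY (row NE7b, node U5c; (180)∕(181)∕(200)
# BY NAME; [folklore])

Cell `pub-balaban`, sub-cell `t4`, spine estimate NE7b (`T4WeightBudget.RelWeightBound`; the cell's OWN estimate — NOT PRINTED in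
[Bałaban 1983–89], NOT PROVED).  Crux-route work under `Spine/NE7b/` by the row OWNER (`t4-ne7b-p1` gen 124, file (201)) under FREEZE
(0)'s crux-prover clause; NOTHING of Bałaban's is named as a Lean object, valued or asserted; no `T4Continuum/Support` leaf typed; no `def`,
no notation (block means, response kernels and the response part WRITTEN OUT as finite sums and series; `u` enters with its displayed
equation); zero `sorry`.  Imports (BY NAME): the OWNER's (200) `…SupZdResponseKernel` (`tsum_exp_conv_le`, `zd_response_kernel`; through it
(180) `zd_propagator_exists`, (181) `zd_bounded_solution_unique`), Mathlib's `Summable.tsum_finsetSum ∕ tsum_mul_left ∕ tsum_add ∕ tsum_sub`,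
`norm_tsum_le_tsum_norm`, `tsum_eq_single`.

WHY (located).  § [NE7bP1-G123-HANDOFF] NEXT (3)(a), last clause: the covariance on `ℤ^d` by name.  On the torus ((139)) the response part
is the double FINITE sum `Σ_{y′}(Σ_{y″}T⁻¹(y′,y″)m(y″))ψ_{y′}`; on `ℤ^d` the same double series would need Fubini, but grouping it as
`Σ′_{b″}m(b″)·h_{b″}` with (200)'s response kernels `h_{b″} = Σ′_{b′}M(b′,b″)Ψ_{b′}` (already summed, bounded by `C_re^{−δ_r|blk n p − b″|₁}`,
with unit block mean at `b″` and `H_Vh_{b″} = M(blk n ·, b″)`) leaves ONE series, dominated by the convolution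
`C₀‖f‖e^{−δ₀|b″ − b₀|₁}·C_re^{−δ_r|blk n p − b″|₁}` (the block means of `u` decay by (180)+(181)): absolutely convergent with an exponential
bound ((200) §1), its block means are `Σ′_{b″}m(b″)δ_{bb″} = m(b)` (finite block sum through the series), and the stencil of `H_V` passes
through it termwise.

WHAT IS PROVED ([folklore]; `X d = ℤ^d`; everything DISPLAYED): **`zd_fluctuation`** (THE END: `∃ C δ > 0`: for ALL `n, V, Ψ`, ANY cube limit
`M`, every block `b₀`, every `f` supported in `B n b₀` with `|f| ≤ M_f`, every bounded solution `u` of `H_Vu = f`: the response series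
converges absolutely at every point, (i) `|u(p) − h(p)| ≤ CM_fe^{−δ|blk n p − b₀|₁}`, (ii) `(n+1)^{−d}Σ_{B n b}(u − h) = 0` for every `b`,
(iii) `H_V(u − h)(p) = f(p) − Σ′_{b″}m(b″)M(blk n p, b″)`); §2 toy.

HONEST (what this is NOT).  Block sources (general bounded `f` by superposition, (196) §1's pattern — not typed here); the torus → `ℤ^d`
limits of response and covariance ((199)'s pattern) and the `H + K` column on `ℤ^d` are the sequel; `d ≥ 3` only; the LINEAR column only;
scalar skeleton ((A3), NC-NE7b-α UNRULED); nothing of the covariant propagators of [B4]–[B6]; nothing of Bałaban's asserted.  BY-NAME EFFECT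
ON THE WALL: NONE.  NE7b NOT PRINTED ∕ NOT PROVED; spine PROVED 0∕9; rung (B)+1 — the programme's measures remain FINITE-torus statements;
NOT the mass gap, NOT Clay.  HONEST DEPENDENCY: continuum YM on T⁴ ⇐ BetaPertH ∧ nine spine estimates (0∕9 proved); BetaPertH ⇐ (D1) ∧ (D4)
∧ CAP+tail; G-an2-4 gates asym, D1 and NE2∕3∕4.
-/

set_option autoImplicit false

noncomputable section

namespace Summit.QuantumFields.BalabanUV.T4Continuum.NE7b.SupZdCovarianceKernel

open Real Filter Topology
open Literature.MathematicalPhysics.QuantumFieldTheory.Balaban1983to89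
open B6QGQLower276 (X e blk B side chart mem_B sum_B sum_B_const card_cube blk_chart)
open SupZdPropagatorLimit (zd_propagator_exists)
open SupZdPropagatorUniqueness (zd_bounded_solution_unique)
open SupZdResponseKernel (tsum_exp_conv_le zd_response_kernel)

variable {d : ℕ}

/-! ## §1. THE END: the fluctuation part of the bounded solution of a block source — decay, zero block means, the equation -/

/-- **HEADLINE — THE INFINITE-VOLUME FLUCTUATION COVARIANCE ON A BLOCK SOURCE**: `d ≥ 3`, `a > 0`, `λ < min(2,a)`, `Λ ≥ 0` ⟹ `∃ C δ > 0`
(from `(d, a, λ, Λ)` ONLY) such that for ALL `n`, `V : ℤ^d → [−λ, Λ]`, ANY bounded block columns `Ψ` of `H_V`, ANY cube limit `M` (= `T_∞⁻¹`),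
every block `b₀`, every source `f` supported in `B n b₀` with `|f| ≤ M_f`, and THE bounded solution `u` of `H_Vu = f`: with the block means
`m(b″) = (n+1)^{−d}Σ_{B n b″}u` and the response part `h = Σ′_{b″}m(b″)·h_{b″}` (`h_{b″} = Σ′_{b′}M(b′,b″)Ψ_{b′}`, (200)): the series converges
absolutely, (i) `|u(p) − h(p)| ≤ C·M_f·e^{−δ|blk n p − b₀|₁}`; (ii) `Q′(u − h) = 0` (every block mean of the fluctuation part vanishes);
(iii) `H_V(u − h) = f − Σ′_{b″}m(b″)M(blk n ·, b″)` — the displays `C f = u − h`, `Q′C = 0`, `H C f = f − Q′*(coarse)` of the road's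
fluctuation covariance `C = H⁻¹ − H⁻¹Q′*(Q′H⁻¹Q′*)⁻¹Q′H⁻¹` ((100)∕(139)), now on `ℤ^d` and POINTWISE. [folklore] -/
theorem zd_fluctuation (hd : 3 ≤ d) (a : ℝ) (ha : 0 < a) {lam Lam : ℝ} (hlam : lam < min 2 a) (hLam : 0 ≤ Lam) :
    ∃ C δ : ℝ, 0 < C ∧ 0 < δ ∧ ∀ (n : ℕ) (V : X d → ℝ), (∀ p, -lam ≤ V p) → (∀ p, V p ≤ Lam) →
      ∀ (Ψ : X d → X d → ℝ) (BΨ : X d → ℝ), (∀ b' p, |Ψ b' p| ≤ BΨ b') →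
      (∀ b' p, ((n : ℝ) + 1) ^ 2 * ∑ μ, (2 * Ψ b' p - Ψ b' (p + e μ) - Ψ b' (p - e μ))
        + a / ((n : ℝ) + 1) ^ d * ∑ q ∈ B n (blk n p), Ψ b' q + V p * Ψ b' p = if blk n p = b' then 1 else 0) →
      ∀ (M : X d → X d → ℝ), (∀ b b' : X d, Tendsto (fun R : ℕ =>
          if h : b ∈ (Fintype.piFinset fun _ : Fin d => Finset.Icc (-(R : ℤ)) R) ∧
              b' ∈ (Fintype.piFinset fun _ : Fin d => Finset.Icc (-(R : ℤ)) R)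
            then (Matrix.of fun c c' : ↥(Fintype.piFinset fun _ : Fin d => Finset.Icc (-(R : ℤ)) R) =>
              (((n : ℝ) + 1) ^ d)⁻¹ * ∑ q ∈ B n (c : X d), Ψ (c' : X d) q)⁻¹ ⟨b, h.1⟩ ⟨b', h.2⟩ else 0)
        atTop (𝓝 (M b b'))) →
      ∀ (b₀ : X d) (Mf : ℝ) (f : X d → ℝ), (∀ p, blk n p ≠ b₀ → f p = 0) → (∀ p, |f p| ≤ Mf) →
      ∀ (u : X d → ℝ) (Bu : ℝ), (∀ p, |u p| ≤ Bu) →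
      (∀ p, ((n : ℝ) + 1) ^ 2 * ∑ μ, (2 * u p - u (p + e μ) - u (p - e μ))
        + a / ((n : ℝ) + 1) ^ d * ∑ q ∈ B n (blk n p), u q + V p * u p = f p) →
        (∀ p, Summable fun b'' : X d => ((((n : ℝ) + 1) ^ d)⁻¹ * ∑ q ∈ B n b'', u q) * ∑' b' : X d, M b' b'' * Ψ b' p) ∧
        (∀ p, |u p - ∑' b'' : X d, ((((n : ℝ) + 1) ^ d)⁻¹ * ∑ q ∈ B n b'', u q) * ∑' b' : X d, M b' b'' * Ψ b' p|
          ≤ C * Mf * exp (-(δ * ∑ i, (((blk n p i - b₀ i).natAbs : ℕ) : ℝ)))) ∧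
        (∀ b, (((n : ℝ) + 1) ^ d)⁻¹ * ∑ q ∈ B n b,
          (u q - ∑' b'' : X d, ((((n : ℝ) + 1) ^ d)⁻¹ * ∑ q' ∈ B n b'', u q') * ∑' b' : X d, M b' b'' * Ψ b' q) = 0) ∧
        (∀ p, ((n : ℝ) + 1) ^ 2 * ∑ μ,
            (2 * (u p - ∑' b'' : X d, ((((n : ℝ) + 1) ^ d)⁻¹ * ∑ q ∈ B n b'', u q) * ∑' b' : X d, M b' b'' * Ψ b' p)
            - (u (p + e μ) - ∑' b'' : X d, ((((n : ℝ) + 1) ^ d)⁻¹ * ∑ q ∈ B n b'', u q) * ∑' b' : X d, M b' b'' * Ψ b' (p + e μ))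
            - (u (p - e μ) - ∑' b'' : X d, ((((n : ℝ) + 1) ^ d)⁻¹ * ∑ q ∈ B n b'', u q) * ∑' b' : X d, M b' b'' * Ψ b' (p - e μ)))
          + a / ((n : ℝ) + 1) ^ d * ∑ q ∈ B n (blk n p),
            (u q - ∑' b'' : X d, ((((n : ℝ) + 1) ^ d)⁻¹ * ∑ q' ∈ B n b'', u q') * ∑' b' : X d, M b' b'' * Ψ b' q)
          + V p * (u p - ∑' b'' : X d, ((((n : ℝ) + 1) ^ d)⁻¹ * ∑ q ∈ B n b'', u q) * ∑' b' : X d, M b' b'' * Ψ b' p)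
          = f p - ∑' b'' : X d, ((((n : ℝ) + 1) ^ d)⁻¹ * ∑ q ∈ B n b'', u q) * M (blk n p) b'') := by
  classical
  obtain ⟨C₀, δ₀, hC₀, hδ₀, H180⟩ := zd_propagator_exists (d := d) hd a ha hlam hLam
  obtain ⟨Cr, δr, hCr, hδr, H200⟩ := zd_response_kernel (d := d) hd a ha hlam hLam
  set m : ℝ := min δ₀ δr with hm
  have hm0 : 0 < m := lt_min hδ₀ hδr
  have hmδ₀ : m ≤ δ₀ := min_le_left _ _
  have hmδr : m ≤ δr := min_le_right _ _
  set K : ℝ := (2 * (1 - exp (-(m / 2)))⁻¹) ^ d with hK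
  have hK0 : 0 < K := pow_pos (mul_pos two_pos (inv_pos.2 (sub_pos.2 (exp_lt_one_iff.2 (by linarith))))) d
  refine ⟨C₀ + C₀ * Cr * K, m / 2, by positivity, by positivity, ?_⟩
  intro n V hV hV' Ψ BΨ hΨB hΨ M hM b₀ Mf f hf0 hfM u Bu huB hu
  have hMf : 0 ≤ Mf := (abs_nonneg _).trans (hfM 0)
  have hvol : (0 : ℝ) < ((n : ℝ) + 1) ^ d := by positivity
  have hrbd := H200 n V hV hV' Ψ BΨ hΨB hΨ M hM
  -- abbreviations: block means of `u` and the response kernels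
  obtain ⟨mu, hmu⟩ : ∃ mu : X d → ℝ, ∀ b'', mu b'' = (((n : ℝ) + 1) ^ d)⁻¹ * ∑ q ∈ B n b'', u q := ⟨_, fun _ => rfl⟩
  obtain ⟨hr, hhr⟩ : ∃ hr : X d → X d → ℝ, ∀ b'' p, hr b'' p = ∑' b' : X d, M b' b'' * Ψ b' p := ⟨_, fun _ _ => rfl⟩
  -- `u` is (180)'s decaying solution ((181)), hence its block means decay
  obtain ⟨v, hveq, hvdec⟩ := H180 n V hV hV' b₀ Mf f hf0 hfM
  have hvB : ∀ p, |v p| ≤ C₀ * Mf := fun p =>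
    (le_mul_of_one_le_left (abs_nonneg _) (one_le_exp (by positivity))).trans (hvdec p)
  have huv : u = v := zd_bounded_solution_unique hd a ha hlam hLam n V hV hV' f u v huB hvB hu hveq
  have hud : ∀ p, |u p| ≤ C₀ * Mf * exp (-(δ₀ * ∑ i, (((blk n p i - b₀ i).natAbs : ℕ) : ℝ))) := fun p => by
    have h := hvdec p
    rw [← huv] at h
    have hE := exp_pos (δ₀ * ∑ i, (((blk n p i - b₀ i).natAbs : ℕ) : ℝ))
    rw [exp_neg, ← div_eq_mul_inv, le_div_iff₀ hE, mul_comm]; exact h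
  have hmud : ∀ b'', |mu b''| ≤ C₀ * Mf * exp (-(m * ∑ i, (((b'' i - b₀ i).natAbs : ℕ) : ℝ))) := by
    intro b''
    rw [hmu, abs_mul, abs_inv, abs_of_pos hvol, inv_mul_le_iff₀ hvol]
    calc |∑ q ∈ B n b'', u q| ≤ ∑ q ∈ B n b'', |u q| := Finset.abs_sum_le_sum_abs _ _
      _ ≤ ∑ _q ∈ B n b'', C₀ * Mf * exp (-(m * ∑ i, (((b'' i - b₀ i).natAbs : ℕ) : ℝ))) := Finset.sum_le_sum fun q hq => by
          refine (hud q).trans ?_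
          rw [mem_B.1 hq]
          exact mul_le_mul_of_nonneg_left (exp_le_exp.2 (by
            nlinarith [show (0:ℝ) ≤ ∑ i, (((b'' i - b₀ i).natAbs : ℕ) : ℝ) by positivity])) (by positivity)
      _ = _ := sum_B_const _ _
  have hrd : ∀ b'' p, |hr b'' p| ≤ Cr * exp (-(m * ∑ i, (((blk n p i - b'' i).natAbs : ℕ) : ℝ))) := fun b'' p => by
    rw [hhr]
    refine ((hrbd b'').2.1 p).trans (mul_le_mul_of_nonneg_left (exp_le_exp.2 ?_) hCr.le)
    nlinarith [show (0:ℝ) ≤ ∑ i, (((blk n p i - b'' i).natAbs : ℕ) : ℝ) by positivity]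
  -- the response part: termwise domination by a convolution, absolute convergence, decay
  have hdom : ∀ p b'', |mu b'' * hr b'' p| ≤ C₀ * Mf * Cr * (exp (-(m * ∑ i, (((b'' i - b₀ i).natAbs : ℕ) : ℝ)))
      * exp (-(m * ∑ i, (((blk n p i - b'' i).natAbs : ℕ) : ℝ)))) := fun p b'' => by
    rw [abs_mul]
    calc |mu b''| * |hr b'' p| ≤ (C₀ * Mf * exp (-(m * ∑ i, (((b'' i - b₀ i).natAbs : ℕ) : ℝ))))
          * (Cr * exp (-(m * ∑ i, (((blk n p i - b'' i).natAbs : ℕ) : ℝ)))) :=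
          mul_le_mul (hmud b'') (hrd b'' p) (abs_nonneg _) (by positivity)
      _ = _ := by ring
  have hs : ∀ p, Summable fun b'' : X d => mu b'' * hr b'' p := fun p =>
    Summable.of_norm_bounded (((tsum_exp_conv_le hm0 b₀ (blk n p)).1).mul_left (C₀ * Mf * Cr)) fun b'' => by
      rw [Real.norm_eq_abs]; exact hdom p b''
  have hhd : ∀ p, |∑' b'' : X d, mu b'' * hr b'' p| ≤ C₀ * Mf * Cr * K * exp (-(m / 2 * ∑ i, (((blk n p i - b₀ i).natAbs : ℕ) : ℝ))) := by
    intro p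
    obtain ⟨hcs, hcb⟩ := tsum_exp_conv_le hm0 b₀ (blk n p)
    have h1 : |∑' b'' : X d, mu b'' * hr b'' p| ≤ ∑' b'' : X d, |mu b'' * hr b'' p| := by
      have := norm_tsum_le_tsum_norm (hs p).norm
      simpa only [Real.norm_eq_abs] using this
    have h2 := (hs p).abs.tsum_le_tsum (hdom p) (hcs.mul_left (C₀ * Mf * Cr))
    rw [Summable.tsum_mul_left _ hcs] at h2
    have h3 := mul_le_mul_of_nonneg_left hcb (show 0 ≤ C₀ * Mf * Cr by positivity)
    calc |∑' b'' : X d, mu b'' * hr b'' p| ≤ C₀ * Mf * Cr * ((2 * (1 - exp (-(m / 2)))⁻¹) ^ d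
          * exp (-(m / 2 * ∑ i, (((blk n p i - b₀ i).natAbs : ℕ) : ℝ)))) := h1.trans (h2.trans h3)
      _ = _ := by rw [hK]; ring
  -- fold the displays
  have efold : ∀ p, (fun b'' : X d => ((((n : ℝ) + 1) ^ d)⁻¹ * ∑ q ∈ B n b'', u q) * ∑' b' : X d, M b' b'' * Ψ b' p)
      = fun b'' => mu b'' * hr b'' p := fun p => funext fun b'' => by rw [hmu, hhr]
  simp only [efold]
  refine ⟨hs, fun p => ?_, fun b => ?_, fun p => ?_⟩
  · -- (i) decay of the fluctuation part
    have e1 := hud p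
    have e2 := hhd p
    have e3 : C₀ * Mf * exp (-(δ₀ * ∑ i, (((blk n p i - b₀ i).natAbs : ℕ) : ℝ)))
        ≤ C₀ * Mf * exp (-(m / 2 * ∑ i, (((blk n p i - b₀ i).natAbs : ℕ) : ℝ))) :=
      mul_le_mul_of_nonneg_left (exp_le_exp.2 (by
        nlinarith [show (0:ℝ) ≤ ∑ i, (((blk n p i - b₀ i).natAbs : ℕ) : ℝ) by positivity])) (by positivity)
    calc |u p - ∑' b'' : X d, mu b'' * hr b'' p| ≤ |u p| + |∑' b'' : X d, mu b'' * hr b'' p| := abs_sub _ _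
      _ ≤ C₀ * Mf * exp (-(m / 2 * ∑ i, (((blk n p i - b₀ i).natAbs : ℕ) : ℝ)))
          + C₀ * Mf * Cr * K * exp (-(m / 2 * ∑ i, (((blk n p i - b₀ i).natAbs : ℕ) : ℝ))) := add_le_add (e1.trans e3) e2
      _ = (C₀ + C₀ * Cr * K) * Mf * exp (-(m / 2 * ∑ i, (((blk n p i - b₀ i).natAbs : ℕ) : ℝ))) := by ring
  · -- (ii) zero block means: the block means of the response part are those of `u`
    have hmean : (((n : ℝ) + 1) ^ d)⁻¹ * ∑ q ∈ B n b, ∑' b'' : X d, mu b'' * hr b'' q = mu b := by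
      rw [← Summable.tsum_finsetSum (fun q _ => hs q), ← Summable.tsum_mul_left _ (summable_sum fun q _ => hs q)]
      have e1 : ∀ b'' : X d, (((n : ℝ) + 1) ^ d)⁻¹ * ∑ q ∈ B n b, mu b'' * hr b'' q = mu b'' * (if b = b'' then 1 else 0) := by
        intro b''
        rw [← (hrbd b'').2.2.1 b, Finset.mul_sum, Finset.mul_sum, Finset.mul_sum]
        exact Finset.sum_congr rfl fun q _ => by rw [hhr]; ring
      simp only [e1]
      rw [tsum_eq_single b (fun b'' hb'' => by rw [if_neg (Ne.symm hb''), mul_zero]), if_pos rfl, mul_one]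
    rw [Finset.sum_sub_distrib, mul_sub, hmean, hmu, sub_self]
  · -- (iii) the equation: the stencil of `H_V` through `Σ′_{b″}` ((200) (iii) termwise), and linearity
    have hpt : ∑' b'' : X d, (((n : ℝ) + 1) ^ 2 * ∑ μ, (2 * (mu b'' * hr b'' p) - mu b'' * hr b'' (p + e μ) - mu b'' * hr b'' (p - e μ))
        + a / ((n : ℝ) + 1) ^ d * ∑ q ∈ B n (blk n p), mu b'' * hr b'' q + V p * (mu b'' * hr b'' p))
        = ∑' b'' : X d, mu b'' * M (blk n p) b'' := by
      refine tsum_congr fun b'' => ?_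
      have h3 := (hrbd b'').2.2.2 p
      simp only [← hhr] at h3
      rw [← h3, ← Finset.mul_sum]
      have e2 : ∑ μ, (2 * (mu b'' * hr b'' p) - mu b'' * hr b'' (p + e μ) - mu b'' * hr b'' (p - e μ))
          = mu b'' * ∑ μ, (2 * hr b'' p - hr b'' (p + e μ) - hr b'' (p - e μ)) := by
        rw [Finset.mul_sum]; exact Finset.sum_congr rfl fun μ _ => by ring
      rw [e2]; ring
    have hS1 : ∀ μ : Fin d, Summable fun b'' : X d => 2 * (mu b'' * hr b'' p) - mu b'' * hr b'' (p + e μ) - mu b'' * hr b'' (p - e μ) :=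
      fun μ => (((hs p).mul_left 2).sub (hs (p + e μ))).sub (hs (p - e μ))
    have hS1s : Summable fun b'' : X d => ∑ μ, (2 * (mu b'' * hr b'' p) - mu b'' * hr b'' (p + e μ) - mu b'' * hr b'' (p - e μ)) :=
      summable_sum fun μ _ => hS1 μ
    have hS2 : Summable fun b'' : X d => ∑ q ∈ B n (blk n p), mu b'' * hr b'' q := summable_sum fun q _ => hs q
    have hT1 : ∑' b'' : X d, ∑ μ, (2 * (mu b'' * hr b'' p) - mu b'' * hr b'' (p + e μ) - mu b'' * hr b'' (p - e μ))
        = ∑ μ, (2 * (∑' b'' : X d, mu b'' * hr b'' p) - (∑' b'' : X d, mu b'' * hr b'' (p + e μ))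
          - (∑' b'' : X d, mu b'' * hr b'' (p - e μ))) := by
      rw [Summable.tsum_finsetSum fun μ _ => hS1 μ]
      refine Finset.sum_congr rfl fun μ _ => ?_
      rw [(((hs p).mul_left 2).sub (hs (p + e μ))).tsum_sub (hs (p - e μ)), ((hs p).mul_left 2).tsum_sub (hs (p + e μ)),
        (hs p).tsum_mul_left 2]
    have hT2 : ∑' b'' : X d, ∑ q ∈ B n (blk n p), mu b'' * hr b'' q = ∑ q ∈ B n (blk n p), ∑' b'' : X d, mu b'' * hr b'' q :=
      Summable.tsum_finsetSum fun q _ => hs q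
    have hmain : ∑' b'' : X d, (((n : ℝ) + 1) ^ 2 * ∑ μ, (2 * (mu b'' * hr b'' p) - mu b'' * hr b'' (p + e μ) - mu b'' * hr b'' (p - e μ))
        + a / ((n : ℝ) + 1) ^ d * ∑ q ∈ B n (blk n p), mu b'' * hr b'' q + V p * (mu b'' * hr b'' p))
        = ((n : ℝ) + 1) ^ 2 * ∑' b'' : X d, ∑ μ, (2 * (mu b'' * hr b'' p) - mu b'' * hr b'' (p + e μ) - mu b'' * hr b'' (p - e μ))
          + a / ((n : ℝ) + 1) ^ d * ∑' b'' : X d, ∑ q ∈ B n (blk n p), mu b'' * hr b'' q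
          + V p * ∑' b'' : X d, mu b'' * hr b'' p := by
      rw [Summable.tsum_add ((hS1s.mul_left _).add (hS2.mul_left _)) ((hs p).mul_left _),
        Summable.tsum_add (hS1s.mul_left _) (hS2.mul_left _), hS1s.tsum_mul_left (((n : ℝ) + 1) ^ 2),
        hS2.tsum_mul_left (a / ((n : ℝ) + 1) ^ d), (hs p).tsum_mul_left (V p)]
    -- `H(u − h) = Hu − Hh`
    have hHh : ((n : ℝ) + 1) ^ 2 * ∑ μ, (2 * (∑' b'' : X d, mu b'' * hr b'' p) - (∑' b'' : X d, mu b'' * hr b'' (p + e μ))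
          - (∑' b'' : X d, mu b'' * hr b'' (p - e μ)))
        + a / ((n : ℝ) + 1) ^ d * ∑ q ∈ B n (blk n p), (∑' b'' : X d, mu b'' * hr b'' q) + V p * (∑' b'' : X d, mu b'' * hr b'' p)
        = ∑' b'' : X d, mu b'' * M (blk n p) b'' := by rw [← hpt, hmain, hT1, hT2]
    have efold2 : (fun b'' : X d => ((((n : ℝ) + 1) ^ d)⁻¹ * ∑ q ∈ B n b'', u q) * M (blk n p) b'') = fun b'' => mu b'' * M (blk n p) b'' :=
      funext fun b'' => by rw [hmu]
    rw [efold2, ← hHh, ← hu p]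
    have e1 : ∑ μ, (2 * (u p - ∑' b'' : X d, mu b'' * hr b'' p) - (u (p + e μ) - ∑' b'' : X d, mu b'' * hr b'' (p + e μ))
        - (u (p - e μ) - ∑' b'' : X d, mu b'' * hr b'' (p - e μ)))
        = ∑ μ, (2 * u p - u (p + e μ) - u (p - e μ)) - ∑ μ, (2 * (∑' b'' : X d, mu b'' * hr b'' p)
          - (∑' b'' : X d, mu b'' * hr b'' (p + e μ)) - (∑' b'' : X d, mu b'' * hr b'' (p - e μ))) := by
      rw [← Finset.sum_sub_distrib]; exact Finset.sum_congr rfl fun μ _ => by ring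
    have e2 : ∑ q ∈ B n (blk n p), (u q - ∑' b'' : X d, mu b'' * hr b'' q)
        = ∑ q ∈ B n (blk n p), u q - ∑ q ∈ B n (blk n p), ∑' b'' : X d, mu b'' * hr b'' q :=
      Finset.sum_sub_distrib (f := fun q => u q) (g := fun q => ∑' b'' : X d, mu b'' * hr b'' q)
    rw [e1, e2]
    ring

/-! ## §2. Toy -/

/-- Toy (`d = 3`, `a = 1`, `λ = 0`, `Λ = 1`): the constants of the fluctuation estimate exist. -/
example : ∃ C δ : ℝ, 0 < C ∧ 0 < δ :=
  let ⟨C, δ, hC, hδ, _⟩ := zd_fluctuation (d := 3) le_rfl 1 one_pos (lam := 0) (Lam := 1)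
    (by rw [min_eq_right (by norm_num : (1 : ℝ) ≤ 2)]; norm_num) zero_le_one
  ⟨C, δ, hC, hδ⟩

end Summit.QuantumFields.BalabanUV.T4Continuum.NE7b.SupZdCovarianceKernel
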